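import Literature.AlgebraicGeometry.ModuliOfAbelianVarieties.SiegelModuliTower
import Literature.AlgebraicGeometry.AbelianSchemes.LevelStructureRefinement
import Literature.AlgebraicGeometry.AbelianSchemes.PolarizedAbelianSchemeWithLevelBaseChange
import HarnessLib

/-!
# The level-lowering maps of the Siegel moduli tower are SURJECTIVE on geometric points
# ([MumfordFogartyKirwan1994, App. 7A (p. 235) «finite morphisms `𝒜_{nm} → 𝒜_n`», Ch. 7 §3 Lemma 7.11]; [Deligne1971TravauxShimura, 4.16–4.17])

Topic `AlgebraicGeometry/ModuliOfAbelianVarieties`; namespace `Literature.AlgebraicGeometry.ModuliOfAbelianVarieties.SiegelModuliTower`.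
THEOREMS ONLY (no definition, no named fact, no instance, no notation, no `sorry`).

For a family `𝓜 K` of fine moduli carriers at the Siegel levels (★ `SiegelFineModuliScheme`) and an arrow `f : K ⟶ K′`
(`N(K′) ∣ N(K)`), the transition morphism ★ `SiegelModuliTower.tr hg 𝓜 f : (𝓜 K).M ⟶ (𝓜 K′).M` hits every geometric point:
a point `x : Spec Ω → (𝓜 K′).M` over `ℚ` (`Ω` algebraically closed) classifies the pull-back `P = x^* univ` of the universal
triple (★ `PolarizedAbelianSchemeWithLevel.baseChange`, `eq_classifyingMap`); its level-`N(K′)` structure REFINES to a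
symplectic-liftable level-`N(K)` structure `η` (★ `LevelStructure.exists_refinement_of_isSymplecticLiftable` — the two layers
of one symplectic tower `ẑ^{2g} ⥲ T̂ A`, [Lan2013PELCompactifications] Def. 1.3.6.2); the triple `Q = (A, λ, η)` over `Spec Ω`
has `Q.changeLevel = P`, so its classifying point `y` satisfies `y ≫ tr f = x` (★ `classifyingMap_comp_tr`).  This is the
point-set half of «`𝒜_{g,δ,N} = 𝒜_{g,δ,Nk}/Γ`» ([MumfordFogartyKirwan1994] Ch. 7 §3 p. 139) and of the surjectivity in Lemma 7.11.

* `SiegelModuliTower.exists_comp_tr_eq` — THE HEAD: `∀ x : specOver ℚ Ω ⟶ (𝓜 K′).M, ∃ y, y ≫ tr hg 𝓜 f = x`.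
* `SiegelModuliTower.surjective_comp_tr` — the same as surjectivity of `(· ≫ tr f)` on `Ω`-points over `ℚ`.

Cell hodgecm-mathlib (D-0151), SOCKETS-F §3 N4 / Hecke-link road H6′ (B-p14 (g14)); count-neutral capital.  HC_CM is proved
only modulo the 7 printed citations until rung 0 closes; this file discharges none of them.

## References
* [MumfordFogartyKirwan1994] D. Mumford, J. Fogarty, F. Kirwan, *Geometric Invariant Theory*, 3rd ed. (1994), Ch. 7 §3
  (p. 139) and Lemma 7.11, App. 7A (p. 235).
* [Deligne1971TravauxShimura] P. Deligne, *Travaux de Shimura* (1971), 1.8 (p. 129), 4.16–4.17 (p. 150).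
* [Lan2013PELCompactifications] K.-W. Lan (2013), §1.3.6 Def. 1.3.6.2 (p. 80), Lemma 1.3.6.5 (p. 81).
-/

set_option autoImplicit false

noncomputable section

open CategoryTheory CategoryTheory.Limits AlgebraicGeometry

namespace Literature.AlgebraicGeometry.ModuliOfAbelianVarieties

open Literature.AlgebraicGeometry.Motives (SchemeOver specOver)
open Literature.AlgebraicGeometry.AbelianSchemes (PolarizedAbelianSchemeWithLevel AbelianSchemeOver)

namespace SiegelModuliTower

variable {g : ℕ} {δ : Fin g → ℕ}

/-- `Spec Ω` over `ℚ` is locally noetherian (a field) — the test class of `classify`.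
[cite: MumfordFogartyKirwan1994, Ch. 7 §2 Definition 7.2 (p. 129)] -/
theorem isLocallyNoetherian_specOver_left (Ω : Type) [Field Ω] [Algebra ℚ Ω] :
    IsLocallyNoetherian (specOver ℚ Ω).left :=
  inferInstanceAs (IsLocallyNoetherian (Spec (CommRingCat.of Ω)))

/-- Two triples with the same underlying data and EQUAL level structures are equal (the `symplectic` field is a
proposition). [cite: MumfordFogartyKirwan1994, Ch. 7 §2 Definition 7.2 (p. 129)] -/
theorem mk_eq_mk_of_level_eq {S : Scheme.{0}} {N : ℕ} (P : PolarizedAbelianSchemeWithLevel g N δ S) {N' : ℕ}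
    {φ ψ : P.A.LevelStructure g N'} (hφ : φ.IsSymplecticLiftable P.pol δ) (hψ : ψ.IsSymplecticLiftable P.pol δ)
    (h : φ = ψ) :
    (⟨P.A, P.relDim, P.D, P.pol, P.hasType, φ, hφ, P.hatNormalised⟩ : PolarizedAbelianSchemeWithLevel g N' δ S) =
      ⟨P.A, P.relDim, P.D, P.pol, P.hasType, ψ, hψ, P.hatNormalised⟩ := by
  subst h
  rfl

/-- Replacing the level structure of a triple by one whose level change it is gives back the triple after `changeLevel`
(the remaining fields are propositions). [cite: MumfordFogartyKirwan1994, App. 7A (p. 235)] -/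
theorem changeLevel_mk_eq {S : Scheme.{0}} {N N' d : ℕ} (P : PolarizedAbelianSchemeWithLevel g N' δ S)
    (η : P.A.LevelStructure g N) (hηs : η.IsSymplecticLiftable P.pol δ) (hd : N = N' * d) (hN : N ≠ 0)
    (hη : η.changeLevel N' d hd hN = P.level) :
    (⟨P.A, P.relDim, P.D, P.pol, P.hasType, η, hηs, P.hatNormalised⟩ : PolarizedAbelianSchemeWithLevel g N δ S).changeLevel N' d hd hN = P :=
  mk_eq_mk_of_level_eq P _ P.symplectic hη

/-- **THE LEVEL-LOWERING MAPS OF THE SIEGEL TOWER ARE SURJECTIVE ON GEOMETRIC POINTS**: for `f : K ⟶ K′` and every point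
`x : Spec Ω → (𝓜 K′).M` over `ℚ` with `Ω` algebraically closed there is `y : Spec Ω → (𝓜 K).M` over `ℚ` with `y ≫ tr f = x`
— refine the level-`N(K′)` structure of `x^* univ` along the symplectic tower ([Lan2013PELCompactifications] Def. 1.3.6.2) and
classify. [cite: MumfordFogartyKirwan1994, App. 7A (p. 235)] [cite: Deligne1971TravauxShimura, 4.16–4.17 p. 150]
[cite: Lan2013PELCompactifications, §1.3.6 Def. 1.3.6.2 (p. 80) and Lemma 1.3.6.5 (p. 81)] -/
theorem exists_comp_tr_eq (hg : 0 < g) (𝓜 : ∀ K : SiegelLevel δ, SiegelFineModuliScheme g K.N δ)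
    {K K' : SiegelLevel δ} (f : K ⟶ K') {Ω : Type} [Field Ω] [IsAlgClosed Ω] [Algebra ℚ Ω]
    (x : specOver ℚ Ω ⟶ (𝓜 K').M) : ∃ y : specOver ℚ Ω ⟶ (𝓜 K).M, y ≫ tr hg 𝓜 f = x := by
  haveI := isLocallyNoetherian_specOver_left Ω
  haveI : CharZero Ω := charZero_of_injective_algebraMap (algebraMap ℚ Ω).injective
  -- the triple classified by `x`
  let P : PolarizedAbelianSchemeWithLevel g K'.N δ (specOver ℚ Ω).left := (𝓜 K').univ.baseChange x.left
  have hx : x = (𝓜 K').classifyingMap (specOver ℚ Ω) P :=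
    (𝓜 K').eq_classifyingMap (specOver ℚ Ω) P x ⟨_, _, (𝓜 K').univ.baseChange_isBaseChangeVia x.left⟩
  -- refine its level structure along the tower
  obtain ⟨η, hη, hηs⟩ :=
    AbelianSchemeOver.LevelStructure.exists_refinement_of_isSymplecticLiftable (A := P.A) P.relDim P.pol P.level
      P.symplectic (N_eq_mul_div hg f) (N_ne_zero K)
  let Q : PolarizedAbelianSchemeWithLevel g K.N δ (specOver ℚ Ω).left := ⟨P.A, P.relDim, P.D, P.pol, P.hasType, η, hηs, P.hatNormalised⟩
  have hQ : Q.changeLevel K'.N (K.N / K'.N) (N_eq_mul_div hg f) (N_ne_zero K) = P :=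
    changeLevel_mk_eq P η hηs _ _ hη
  refine ⟨(𝓜 K).classifyingMap (specOver ℚ Ω) Q, ?_⟩
  rw [classifyingMap_comp_tr, hQ, ← hx]

/-- The same, as surjectivity of post-composition with `tr f` on `Ω`-points over `ℚ` (`Ω` algebraically closed).
[cite: MumfordFogartyKirwan1994, App. 7A (p. 235)] -/
theorem surjective_comp_tr (hg : 0 < g) (𝓜 : ∀ K : SiegelLevel δ, SiegelFineModuliScheme g K.N δ)
    {K K' : SiegelLevel δ} (f : K ⟶ K') (Ω : Type) [Field Ω] [IsAlgClosed Ω] [Algebra ℚ Ω] :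
    Function.Surjective fun y : specOver ℚ Ω ⟶ (𝓜 K).M => y ≫ tr hg 𝓜 f :=
  fun x => exists_comp_tr_eq hg 𝓜 f x

end SiegelModuliTower

end Literature.AlgebraicGeometry.ModuliOfAbelianVarieties

end
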